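import Summits.QuantumFields.YangMills.Theorems.BalabanUVNodesN19HybridChainRuleTower
import Summits.QuantumFields.YangMills.Theorems.BalabanUVNodesN18KingModelCauchy

/-!
# YM-DAG node N19 (= NE7 proper) — THE HYBRID CHAIN RULE, part 4: IT FIRES IN KING's PRINTED SMALL-FIELD MODEL — runs `K` and `K + n + 1` averaging steps apart
# match in the hybrid sense from some origin, for EVERY fixed gap, by the tower of FILE 2 over the N18 seat's consecutive-run datum (an A2 inhabitant; no new analysis)

Cell `pub-ymgap`, HUMAN RULING D-0062 (Track A) + D-0149 (width seats), WIDTH SEAT `pub-ymgap-dag-n19-w1` (N19 NE7, seat 1 of 3), generation g6, FILE 4; bus CLAIM-4.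
Key item K3⁸ «SpineGivenEndpointR13SepCoPHV» (stmt-QuantumFields-27366); filed `--kind proof --supports` that item `--as helper`.  COUNT-NEUTRAL.  THEOREMS ONLY; 0 `def`;
0 `sorry`.  Imports FILE 2 `…N19HybridChainRuleTower` (p641681; hence FILE 1 p640632) and the N18 seat's `…N18KingModelCauchy` (`YMDAG.N18.KingModelCauchy.hybridNE7_kingSmallField`:
King's `A = 0` scalar small-field Gaussian model INHABITS the spine's `HybridNE7` for CONSECUTIVE runs — one class per level, no bad class, no shells, geometric radius) — CITED BY
NAME, nothing edited.

THE POINT (numbers, not adjectives).  FILE 1–3's binders (two or more hybrid legs on common carriers with shared middle shells) are HYPOTHESES; this file shows them JOINTLY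
INHABITED in a printed model with every hypothesis discharged except the model's data: the consecutive-run datum of `…N18KingModelCauchy` shifted by `i` is the leg
`run (i + K) → run (i + K + 1)` (§1 `hybridNE7_kingSmallField_leg`, FILE 1 `hybridNE7_shift` + one re-association), the legs chain along the tower `R i := run (i + ·)` (FILE 2
`hybridNE7Edge_chain`), so for EVERY fixed gap `n + 1` the dressed small-field partition functions `Z K` and `Z (K + n + 1)` match in the hybrid sense FROM SOME ORIGIN `K₀` for
SOME bad classes ∕ weights ∕ shell weight ∕ radius (§2 ★★ `exists_hybridNE7_kingSmallField_gap`); the two-step case is §2 ★ `exists_hybridNE7_kingSmallField_twoSteps`.  This is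
the composite the chain rule promises, obtained with NO new estimate (the consecutive comparison is the N18 seat's; the gap-`n + 1` comparison would directly be King's (5.10)
telescope — here it is the chain rule's output instead, as a check that the calculus composes real data).

HONEST FRAMING.  King's `A = 0` scalar MODEL ([King1986] template literature), small-field classes only — NOT Bałaban's non-abelian densities; NE7 ∕ NE7b ∕ NE7c for d = 4 NOT
PRINTED ∕ NOT proved; N18 ∕ N19 NOT discharged; K3⁸ OPEN; Track A counts UNMOVED (28∕28 · 5∕27).  One finite four-torus programme at fixed ε; R4 closes the conditional finite-𝕋⁴
rung `BalabanLadder.UV` only — the YM mass gap (Clay) is NOT proved by any of this.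
-/

set_option autoImplicit false

noncomputable section

open MeasureTheory Finset Filter Topology Matrix
open scoped BigOperators

namespace Summit.QuantumFields.YangMills.BalabanUVNodes.N19HybridChainRuleKingModel

open Literature.MathematicalPhysics.QuantumFieldTheory.Balaban1983to89
open Literature.MathematicalPhysics.QuantumFieldTheory.King1986 (aK thetaK)
open Literature.MathematicalPhysics.QuantumFieldTheory.King1986.Torus (effLaplacian)
open Literature.MathematicalPhysics.QuantumFieldTheory.Balaban1983to89.B5Prop11Plancherel (Tor)
open T4MatchingAssembly (HybridNE7)
open YMDAG.N18.KingModelCauchy (hybridNE7_kingSmallField)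
open Summit.QuantumFields.YangMills.BalabanUVNodes.N19HybridChainRule (hybridNE7_shift hybridNE7Edge_trans)
open Summit.QuantumFields.YangMills.BalabanUVNodes.N19HybridChainRuleTower (hybridNE7Edge_chain)

variable {d : ℕ} (M : Fin d → ℕ) [hM : ∀ μ, NeZero (M μ)] {l₀ vol B R : ℝ} {W : (Tor M → ℝ) → ℝ} {Z : ℕ → ℝ → ℝ}

/-! ## §1 The legs: the consecutive-run datum shifted along the run length [bookkeeping] -/

/-- **THE `i`-TH LEG** [bookkeeping ∘ `KingModelCauchy.hybridNE7_kingSmallField` ∘ FILE 1 `hybridNE7_shift`]: in King's small-field model the runs of `i + K` and `i + K + 1`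
averaging steps match in the hybrid sense (one class, no bad class, no shells, radius the model's geometric one shifted by `i`), stated on the tower `R i K := Z (i + K)` — i.e. with
the far run written `Z (i + 1 + K)`. -/
theorem hybridNE7_kingSmallField_leg {a : ℝ} (ha : 0 < a) {L : ℕ} [NeZero L] (hL : 2 ≤ L) {m2 : ℝ} (hm : 0 < m2) (hvol : 0 < vol) (hR : 0 < R) (hB : 0 ≤ B)
    (hWm : Measurable W) (hWb : ∀ φ, |W φ| ≤ B)
    (hZ : ∀ K (t : ℝ), Z K t = ∫ φ in {φ : Tor M → ℝ | ∀ x, |φ x| ≤ R},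
      Real.exp (-(φ ⬝ᵥ (effLaplacian (L ^ (K + 1)) M (aK a L (K + 1)) (((L ^ (K + 1) : ℕ) : ℝ) ^ 2) m2 *ᵥ φ) / 2)) * Real.exp (t * W φ))
    (i : ℕ) :
    HybridNE7 l₀ vol (fun _ => (Finset.univ : Finset Unit)) (fun K t _ => Z (i + K) t) (fun K t _ => Z (i + 1 + K) t) (fun _ _ => ∅) (fun _ => 0)
      (fun _ _ _ => 0) (fun _ _ _ => 0) (fun _ => 0) fun K => thetaK a L (i + K + 1) 1 * a * (R ^ 2 * Fintype.card (Tor M)) / 2 / vol := by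
  have e : (fun (K : ℕ) (t : ℝ) (_ : Unit) => Z (i + K + 1) t) = fun K t _ => Z (i + 1 + K) t := by
    funext K t _
    rw [Nat.add_right_comm]
  rw [← e]
  exact hybridNE7_shift i (hybridNE7_kingSmallField M (l₀ := l₀) ha hL hm hvol hR hB hWm hWb hZ)

/-! ## §2 The composites: any fixed gap, from some origin [bookkeeping ∘ FILE 2] -/

/-- ★★ **RUNS `K₀ + K` AND `K₀ + K + (n + 1)` OF KING's MODEL MATCH IN THE HYBRID SENSE FROM SOME ORIGIN** — the tower `Z (0 + ·) → Z (1 + ·) → ⋯ → Z (n + 1 + ·)` of §1's legs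
composed by FILE 2 `hybridNE7Edge_chain`: `∃ K₀ Bad W Wsh δ, HybridNE7 l₀ vol univ (Z (K₀ + K)) (Z (K₀ + K + (n + 1))) Bad W 0 0 Wsh δ`.  Every hypothesis is the model's data;
the bad classes ∕ weights ∕ radius are the chain rule's composites (existential here). -/
theorem exists_hybridNE7_kingSmallField_gap {a : ℝ} (ha : 0 < a) {L : ℕ} [NeZero L] (hL : 2 ≤ L) {m2 : ℝ} (hm : 0 < m2) (hvol : 0 < vol) (hR : 0 < R) (hB : 0 ≤ B)
    (hWm : Measurable W) (hWb : ∀ φ, |W φ| ≤ B)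
    (hZ : ∀ K (t : ℝ), Z K t = ∫ φ in {φ : Tor M → ℝ | ∀ x, |φ x| ≤ R},
      Real.exp (-(φ ⬝ᵥ (effLaplacian (L ^ (K + 1)) M (aK a L (K + 1)) (((L ^ (K + 1) : ℕ) : ℝ) ^ 2) m2 *ᵥ φ) / 2)) * Real.exp (t * W φ))
    (n : ℕ) :
    ∃ (K₀ : ℕ) (Bad : ℕ → ℝ → Finset Unit) (Wt Wsh δ : ℕ → ℝ),
      HybridNE7 l₀ vol (fun _ => (Finset.univ : Finset Unit)) (fun K t _ => Z (K₀ + K) t) (fun K t _ => Z (K₀ + K + (n + 1)) t) Bad Wt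
        (fun _ _ _ => 0) (fun _ _ _ => 0) Wsh δ := by
  obtain ⟨K₀, Bad, Wt, Wsh, δ, h⟩ := hybridNE7Edge_chain (l₀ := l₀) (vol := vol) (T := fun _ => (Finset.univ : Finset Unit))
    (fun i K t (_ : Unit) => Z (i + K) t) (fun _ _ _ _ => (0 : ℝ)) n
    fun i _ => ⟨_, _, _, _, hybridNE7_kingSmallField_leg M ha hL hm hvol hR hB hWm hWb hZ i⟩
  refine ⟨K₀, Bad, Wt, Wsh, δ, ?_⟩
  have eA : (fun (K : ℕ) (t : ℝ) (_ : Unit) => Z (0 + (K₀ + K)) t) = fun K t _ => Z (K₀ + K) t := by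
    funext K t _
    rw [Nat.zero_add]
  have eB : (fun (K : ℕ) (t : ℝ) (_ : Unit) => Z (n + 1 + (K₀ + K)) t) = fun K t _ => Z (K₀ + K + (n + 1)) t := by
    funext K t _
    rw [Nat.add_comm (n + 1)]
  rw [← eA, ← eB]
  exact h

/-- ★ **THE TWO-STEP CASE**: runs `K₀ + K` and `K₀ + K + 2` match in the hybrid sense from some origin (gap `n + 1 = 2`; equally FILE 1 `hybridNE7Edge_trans` on the legs
`i = 0, 1`). -/
theorem exists_hybridNE7_kingSmallField_twoSteps {a : ℝ} (ha : 0 < a) {L : ℕ} [NeZero L] (hL : 2 ≤ L) {m2 : ℝ} (hm : 0 < m2) (hvol : 0 < vol) (hR : 0 < R) (hB : 0 ≤ B)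
    (hWm : Measurable W) (hWb : ∀ φ, |W φ| ≤ B)
    (hZ : ∀ K (t : ℝ), Z K t = ∫ φ in {φ : Tor M → ℝ | ∀ x, |φ x| ≤ R},
      Real.exp (-(φ ⬝ᵥ (effLaplacian (L ^ (K + 1)) M (aK a L (K + 1)) (((L ^ (K + 1) : ℕ) : ℝ) ^ 2) m2 *ᵥ φ) / 2)) * Real.exp (t * W φ)) :
    ∃ (K₀ : ℕ) (Bad : ℕ → ℝ → Finset Unit) (Wt Wsh δ : ℕ → ℝ),
      HybridNE7 l₀ vol (fun _ => (Finset.univ : Finset Unit)) (fun K t _ => Z (K₀ + K) t) (fun K t _ => Z (K₀ + K + 2) t) Bad Wt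
        (fun _ _ _ => 0) (fun _ _ _ => 0) Wsh δ :=
  exists_hybridNE7_kingSmallField_gap M ha hL hm hvol hR hB hWm hWb hZ 1

end Summit.QuantumFields.YangMills.BalabanUVNodes.N19HybridChainRuleKingModel

end
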